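import Literature.NumberTheory.Automorphic.RankOneOrbit
import HarnessLib

/-!
# The orbit of the highest weight line in semisimple rank one, II: weight raising, limits, charts
(trunk T-AUTOMORPHIC, G25 AutomorphicL; towards `bruhat_rankOne_of_central`, Springer 7.1.5, 7.2.2)

Sequel to `RankOneOrbit.lean` (the hypothesis structure `RankOneOrbitData G T α u m ρ v`: a
rational representation `ρ` with `ρ(T)` diagonal, `v ≠ 0` with line stabiliser `B = T · U_α`,
closed orbit cone, Weyl element `m`). All proved, following the proof of Springer 7.1.5
("*if the last coordinate of `x ∈ P(V)` is non-zero, then `x₀* = lim_{a → 0} ρ(a) x*` exists*"):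

* `coeff_eq_zero_of_twist`: a polynomial with `q(c^d y) = c^Δ q(y)` is a monomial of degree `e`,
  `d e = Δ`; whence **`U_α` raises `γ`-weights** (`rho_uval_apply_eq_zero`, `rho_uval_apply_of_eq`,
  `rho_uval_mulVec_apply`): in weight coordinates `ρ(u(y))ᵢⱼ = 0` for `mᵢ < mⱼ` and `= δᵢⱼ` for
  `mᵢ = mⱼ` (`T`-equivariance `t u(y) t⁻¹ = u(α(t) y)`, `rho_uval_conj`);
* the opposite root group: `isRootHom_weyl` (`y ↦ m⁻¹ u(y) m` is a root homomorphism for `-α`,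
  8.1.1 (i) with 7.1.4, via `IsRootHom.conj`) and `eq_zero_of_rho_uval_fix` (`ρ(u(y)) z₀ = z₀ ⇒ y = 0`, `z₀ = ρ(m) v`; 7.2.2, proof:
  `U ∩ n B n⁻¹ = {e}`);
* limits: `botPart_mem` / `topPart_mem` (the lowest/highest weight parts of a point of the orbit
  cone lie in it, `ConeWeights`), `botPart_fixed_torus` (they span `T`-fixed lines, by the
  separation lemma), `botPart_smul_or_smul` / `topPart_smul_or_smul` (so they are multiples of
  `v` or `z₀`, by `smul_or_smul_of_fixed`);
* extremal weights `Mv = M₀` (of `v`), `Mz = M_∞` (of `z₀`): `minWeight_eq_or`, `maxWeight_eq_or`,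
  **`Mz_lt_Mv`** (orientation `M_∞ < M₀`), `wtInt_mem_Icc`, and the charts
  **`exists_low_coords`** (a point of the cone off the line `k v` has weight-`M_∞` part `c z₀`,
  `c ≠ 0`: "`X ∖ {x₀} ⊆ Ω_∞`") and `exists_high_coords`.

Part III (the affine slice, finite fibres, the curve `U · z₀`, `AffineCurveCriterion` ⇒ Bruhat)
follows.

## References

* [SpringerLAG1998] T. A. Springer, *Linear Algebraic Groups*, 2nd ed. (1998): 7.1.4–7.1.5, 7.2.2,
  8.1.1.
-/

open scoped MatrixGroups IsMulCommutative
open Matrix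

namespace Literature.NumberTheory.Automorphic

variable {k : Type*} [Field k] {n : Type*} [Fintype n] [DecidableEq n]

/-! ### `U_α` raises weights: the matrix of `ρ(u(y))` in weight coordinates -/

section Raise

/-- **Exponents are determined by the function `c ↦ c^e` on `kˣ`** (`k` infinite). [folklore] -/
theorem int_eq_of_forall_zpow_eq [Infinite k] {e₁ e₂ : ℤ} (h : ∀ c : kˣ, c ^ e₁ = c ^ e₂) :
    e₁ = e₂ :=
  zpowGroupHom_units_injective (k := k) (MonoidHom.ext fun c => by simpa using h c)

/-- **A polynomial `q` with `q(c^d y) = c^Δ q(y)` for all `c ∈ kˣ`, `y ∈ k` is a monomial of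
degree `e` with `d e = Δ`**: its coefficient `a_e` vanishes unless `c^{d e} = c^Δ` for all `c`
(`k` infinite). Coefficient-wise form of `Polynomial.eq_C_of_eval_zpow_mul`
(`BigCellReduction.lean`, the case `Δ = 0`; to be merged by a librarian). [folklore] -/
theorem coeff_eq_zero_of_twist [Infinite k] {q : Polynomial k} {d Δ : ℤ}
    (hq : ∀ (c : kˣ) (y : k), q.eval (((c ^ d : kˣ) : k) * y) = ((c ^ Δ : kˣ) : k) * q.eval y)
    {e : ℕ} (he : d * e ≠ Δ) : q.coeff e = 0 := by
  by_contra hne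
  apply he
  apply int_eq_of_forall_zpow_eq (k := k)
  intro c
  -- compare the coefficients of `y^e` in `q(c^d y) = c^Δ q(y)`
  have h1 : q.comp (Polynomial.C ((c ^ d : kˣ) : k) * Polynomial.X) =
      Polynomial.C ((c ^ Δ : kˣ) : k) * q := by
    apply Polynomial.funext
    intro y
    rw [Polynomial.eval_comp, Polynomial.eval_mul, Polynomial.eval_C, Polynomial.eval_X, hq,
      Polynomial.eval_mul, Polynomial.eval_C]
  have h2 := congrArg (fun p : Polynomial k => p.coeff e) h1
  simp only [Polynomial.comp_C_mul_X_coeff, Polynomial.coeff_C_mul] at h2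
  have h3 : ((c ^ d : kˣ) : k) ^ e = ((c ^ Δ : kˣ) : k) :=
    mul_left_cancel₀ hne (h2.trans (mul_comm _ _))
  apply Units.ext
  rw [zpow_mul, zpow_natCast, Units.val_pow_eq_pow_val, h3]

namespace RankOneOrbitData

variable {G T : Subgroup (GL n k)} {α : ↥(characterLattice T)} {u : Multiplicative k →* ↥G}
  {m : GL n k} {N : ℕ} {ρ : ↥G →* GL (Fin N) k} {v : Fin N → k}
variable (h : RankOneOrbitData G T α u m ρ v)
include h

/-- The entries of `ρ(u(y))` are polynomials in `y` (`ρ` and `u` are algebraic). [folklore] -/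
theorem exists_polynomial_rho_uval (i j : Fin N) :
    ∃ q : Polynomial k, ∀ y : k,
      q.eval y = ((ρ (u (Multiplicative.ofAdd y)) : GL (Fin N) k) : Matrix (Fin N) (Fin N) k) i j := by
  obtain ⟨Pu, hPu⟩ := h.rootHom.1
  obtain ⟨Pρ, hPρ⟩ := h.algebraic
  refine ⟨MvPolynomial.aeval Pu (Pρ (Sum.inl (i, j))), fun y => ?_⟩
  rw [← glCoordFun_inl (g := ρ (u (Multiplicative.ofAdd y))) (i := i) (j := j), hPρ,
    ← Polynomial.coe_aeval_eq_eval, ← AlgHom.comp_apply, MvPolynomial.comp_aeval,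
    MvPolynomial.aeval_eq_eval]
  refine congrArg (fun f => MvPolynomial.eval f (Pρ (Sum.inl (i, j)))) (funext fun c => ?_)
  rw [Polynomial.coe_aeval_eq_eval, hPu]

/-- **`T`-equivariance of `ρ(u(y))` in weight coordinates**: `ρ(u(α(t) y))ᵢⱼ = χᵢ(t) ρ(u(y))ᵢⱼ χⱼ(t)⁻¹`
(from the root-homomorphism relation `t u(y) t⁻¹ = u(α(t) y)`, Springer 8.1.1 (i), and
`ρ(t) = diag(χᵢ(t))`). [folklore] -/
theorem rho_uval_conj (t : ↥T) (y : k) (i j : Fin N) :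
    ((ρ (u (Multiplicative.ofAdd (((α : ↥T →* kˣ) t : k) * y))) : GL (Fin N) k) :
        Matrix (Fin N) (Fin N) k) i j =
      ((h.wt i t : kˣ) : k) * ((ρ (u (Multiplicative.ofAdd y)) : GL (Fin N) k) :
        Matrix (Fin N) (Fin N) k) i j * ((h.wt j t⁻¹ : kˣ) : k) := by
  have e := h.rootHom.2.2 t y
  have e' : (Subgroup.inclusion h.maxTorus.1 t : ↥G) = ⟨(t : GL n k), h.maxTorus.1 t.2⟩ := rfl
  rw [← e, map_mul, map_mul, Units.val_mul, Units.val_mul, e']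
  have e'' : (⟨(t : GL n k), h.maxTorus.1 t.2⟩ : ↥G)⁻¹ = ⟨((t⁻¹ : ↥T) : GL n k), h.maxTorus.1 (t⁻¹).2⟩ := rfl
  rw [e'', h.rho_torus_eq_diagonal t, h.rho_torus_eq_diagonal t⁻¹, Matrix.mul_diagonal,
    Matrix.diagonal_mul]
  rfl

/-- The twist identity for the entry polynomials along a cocharacter `γ` with `⟨α, γ⟩ = d`:
`q_{ij}(c^d y) = c^{mᵢ - mⱼ} q_{ij}(y)`. [folklore] -/
theorem rho_uval_twist [IsAlgClosed k] [IsMulCommutative ↥T] (γ : ↥(cocharacterLattice T))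
    (c : kˣ) (y : k) (i j : Fin N) :
    ((ρ (u (Multiplicative.ofAdd
        (((c ^ charPairingInt (α : ↥T →* kˣ) (γ : kˣ →* ↥T) : kˣ) : k) * y))) : GL (Fin N) k) :
        Matrix (Fin N) (Fin N) k) i j =
      ((c ^ (h.wtInt γ i - h.wtInt γ j) : kˣ) : k) *
        ((ρ (u (Multiplicative.ofAdd y)) : GL (Fin N) k) : Matrix (Fin N) (Fin N) k) i j := by
  have hα := charPairingInt_spec_holds (T := T) α.2 γ.2 c
  have hi := charPairingInt_spec_holds (T := T) (h.isAlgebraicChar_wt i) γ.2 c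
  have hj := charPairingInt_spec_holds (T := T) (h.isAlgebraicChar_wt j) γ.2 c
  rw [← hα, h.rho_uval_conj ((γ : kˣ →* ↥T) c) y i j, map_inv, hi, hj, zpow_sub, Units.val_mul]
  show _ = ((c ^ charPairingInt (h.wt i) (γ : kˣ →* ↥T) : kˣ) : k) *
    (((c ^ charPairingInt (h.wt j) (γ : kˣ →* ↥T))⁻¹ : kˣ) : k) * _
  ring

/-- **`U_α` raises `γ`-weights, I**: `ρ(u(y))ᵢⱼ = 0` if `mᵢ < mⱼ` (for `⟨α, γ⟩ > 0`; cf.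
`BigCellReduction.apply_eq_one_apply_of_diagonal_conj`). [folklore] -/
theorem rho_uval_apply_eq_zero [IsAlgClosed k] [IsMulCommutative ↥T] {γ : ↥(cocharacterLattice T)}
    (hd : 0 < charPairingInt (α : ↥T →* kˣ) (γ : kˣ →* ↥T)) {i j : Fin N}
    (hlt : h.wtInt γ i < h.wtInt γ j) (y : k) :
    ((ρ (u (Multiplicative.ofAdd y)) : GL (Fin N) k) : Matrix (Fin N) (Fin N) k) i j = 0 := by
  obtain ⟨q, hq⟩ := h.exists_polynomial_rho_uval i j
  have hq0 : q = 0 := by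
    ext e
    rw [Polynomial.coeff_zero]
    refine coeff_eq_zero_of_twist (d := charPairingInt (α : ↥T →* kˣ) (γ : kˣ →* ↥T))
      (Δ := h.wtInt γ i - h.wtInt γ j) (fun c y => ?_) ?_
    · rw [hq, hq, h.rho_uval_twist γ c y i j]
    · intro he
      have : (0 : ℤ) ≤ charPairingInt (α : ↥T →* kˣ) (γ : kˣ →* ↥T) * e := by positivity
      omega
  rw [← hq, hq0, Polynomial.eval_zero]

/-- **`U_α` raises `γ`-weights, II**: `ρ(u(y))ᵢⱼ = δᵢⱼ` if `mᵢ = mⱼ` (the entry polynomial is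
constant, and `u(0) = 1`). [folklore] -/
theorem rho_uval_apply_of_eq [IsAlgClosed k] [IsMulCommutative ↥T] {γ : ↥(cocharacterLattice T)}
    (hd : 0 < charPairingInt (α : ↥T →* kˣ) (γ : kˣ →* ↥T)) {i j : Fin N}
    (heq : h.wtInt γ i = h.wtInt γ j) (y : k) :
    ((ρ (u (Multiplicative.ofAdd y)) : GL (Fin N) k) : Matrix (Fin N) (Fin N) k) i j =
      if i = j then 1 else 0 := by
  obtain ⟨q, hq⟩ := h.exists_polynomial_rho_uval i j
  -- `q` is constant
  have hqc : ∀ e ≠ 0, q.coeff e = 0 := by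
    intro e he0
    refine coeff_eq_zero_of_twist (d := charPairingInt (α : ↥T →* kˣ) (γ : kˣ →* ↥T))
      (Δ := h.wtInt γ i - h.wtInt γ j) (fun c y => ?_) ?_
    · rw [hq, hq, h.rho_uval_twist γ c y i j]
    · rw [heq, sub_self]
      intro he
      rcases mul_eq_zero.1 he with h1 | h1
      · exact hd.ne' h1
      · exact he0 (by exact_mod_cast h1)
  have hconst : q = Polynomial.C (q.coeff 0) := by
    ext e
    rcases Nat.eq_zero_or_pos e with rfl | hpos
    · simp
    · rw [hqc e hpos.ne', Polynomial.coeff_C, if_neg hpos.ne']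
  have h0 := hq 0
  rw [ofAdd_zero, map_one, map_one, Units.val_one] at h0
  rw [← hq, hconst, Polynomial.eval_C, ← Polynomial.eval_C (a := q.coeff 0) (x := (0 : k)), ← hconst,
    h0, Matrix.one_apply]

/-- **`ρ(u(y))` on a vector of pure `γ`-weight `M`**: the coordinates of weight `M` are unchanged
and those of weight `< M` vanish. [folklore] -/
theorem rho_uval_mulVec_apply [IsAlgClosed k] [IsMulCommutative ↥T] {γ : ↥(cocharacterLattice T)}
    (hd : 0 < charPairingInt (α : ↥T →* kˣ) (γ : kˣ →* ↥T)) {z : Fin N → k} {M : ℤ}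
    (hz : ∀ j, z j ≠ 0 → h.wtInt γ j = M) (y : k) (i : Fin N) (hi : h.wtInt γ i ≤ M) :
    (((ρ (u (Multiplicative.ofAdd y)) : GL (Fin N) k) : Matrix (Fin N) (Fin N) k) *ᵥ z) i =
      if h.wtInt γ i = M then z i else 0 := by
  rw [Matrix.mulVec, dotProduct]
  split_ifs with hiM
  · rw [Finset.sum_eq_single i]
    · rw [h.rho_uval_apply_of_eq hd rfl, if_pos rfl, one_mul]
    · intro j _ hji
      by_cases hzj : z j = 0
      · rw [hzj, mul_zero]
      · rw [h.rho_uval_apply_of_eq hd (hiM.trans (hz j hzj).symm), if_neg (Ne.symm hji), zero_mul]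
    · intro hi'; exact absurd (Finset.mem_univ i) hi'
  · refine Finset.sum_eq_zero fun j _ => ?_
    by_cases hzj : z j = 0
    · rw [hzj, mul_zero]
    · rw [h.rho_uval_apply_eq_zero hd (lt_of_le_of_ne (hz j hzj ▸ hi) (hz j hzj ▸ hiM)), zero_mul]

/-! #### The opposite root group `m⁻¹ U m` -/

/-- `m` inverts `α`: `α(m t m⁻¹) = α(t)⁻¹` (`m ∈ N_G(T) ∖ Z_G(T)` acts on `α` by `-1`,
`charConj_eq_or_eq_inv_of_central`). [cite: SpringerLAG1998, 7.1.4] -/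
theorem charConj_eq_inv [IsAlgClosed k] : charConj h.memN α = α⁻¹ := by
  rcases charConj_eq_or_eq_inv_of_central h.alg h.torus h.ne_one h.central h.memG h.memN with e | e
  · exact absurd (mem_centralizer_of_charConj_eq_of_central h.alg h.torus h.ne_one h.central h.memG
      h.memN e) h.notMemZ
  · exact e

/-- The automorphism `t ↦ m t m⁻¹` of `T` as an equivalence. [folklore] -/
noncomputable def weylEquiv : ↥T ≃* ↥T :=
  { normConj h.memN with
    invFun := normConj (Subgroup.inv_mem _ h.memN)
    left_inv := fun t => Subtype.ext (by simp [mul_assoc])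
    right_inv := fun t => Subtype.ext (by simp [mul_assoc]) }

/-- `weylEquiv t = m t m⁻¹`. [folklore] -/
@[simp] theorem coe_weylEquiv (t : ↥T) : ((h.weylEquiv t : ↥T) : GL n k) = m * t * m⁻¹ := rfl

/-- **`x ↦ m⁻¹ u(x) m` is a root homomorphism for `-α`** (`n U_α n⁻¹ = U_{-α}`; an instance of the
tree's `IsRootHom.conj`, Springer 8.1.1 (i) with 7.1.4). The equivalence `weylEquiv` only uses
`m ∈ N_G(T)` and could live next to `normConj` (`RootSubgroupStructure.lean`).
[cite: SpringerLAG1998, 8.1.1 (i) with 7.1.4] -/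
theorem isRootHom_weyl [IsAlgClosed k] :
    IsRootHom G T h.maxTorus.1 (α : ↥T →* kˣ)⁻¹
      ((MulAut.conj (⟨m, h.memG⟩⁻¹ : ↥G)).toMonoidHom.comp u) := by
  have h1 := h.rootHom.conj (m := (⟨m, h.memG⟩⁻¹ : ↥G)) (σ := h.weylEquiv) fun t =>
    Subtype.ext (by simp [mul_assoc])
  have e : (α : ↥T →* kˣ).comp h.weylEquiv.toMonoidHom = (α : ↥T →* kˣ)⁻¹ := by
    have h2 := congrArg (fun χ : ↥(characterLattice T) => (χ : ↥T →* kˣ)) h.charConj_eq_inv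
    rw [Subgroup.coe_inv] at h2
    rw [← h2]
    rfl
  rwa [e] at h1

/-- `uval` of the opposite root homomorphism. [folklore] -/
theorem uval_weyl (y : k) :
    uval ((MulAut.conj (⟨m, h.memG⟩⁻¹ : ↥G)).toMonoidHom.comp u) y = m⁻¹ * uval u y * m := by
  simp [uval]

/-- **`U_α ∩ m B m⁻¹ = {e}` on the level of the orbit**: if `ρ(u(y))` fixes `z₀ = ρ(m) v` then
`y = 0` (`m⁻¹ u(y) m ∈ B = T U_α` is impossible for `y ≠ 0` as `m⁻¹ U_α m = U_{-α}`,
`IsRootHom.eq_zero_of_uval_eq_torus_mul_uval`). [cite: SpringerLAG1998, 7.2.2 (proof)] -/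
theorem eq_zero_of_rho_uval_fix [IsAlgClosed k] {y : k}
    (hfix : ((ρ (u (Multiplicative.ofAdd y)) : GL (Fin N) k) : Matrix (Fin N) (Fin N) k) *ᵥ
      (((ρ ⟨m, h.memG⟩ : GL (Fin N) k) : Matrix (Fin N) (Fin N) k) *ᵥ v) =
      ((ρ ⟨m, h.memG⟩ : GL (Fin N) k) : Matrix (Fin N) (Fin N) k) *ᵥ v) : y = 0 := by
  haveI : IsMulCommutative ↥T := h.torus.2.1
  have hmem : m⁻¹ * uval u y * m ∈ T ⊔ u.range.map G.subtype := by
    have := h.conj_mem_borel_of_fixed (g := ⟨m, h.memG⟩) (t := uval u y) (uval_mem u y)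
      ⟨1, by rw [one_smul]; exact hfix⟩
    simpa [uval] using this
  obtain ⟨t, ht, x, e⟩ := h.rootHom.mem_sup_iff.1 hmem
  rw [← h.uval_weyl] at e
  exact (h.rootHom.eq_zero_of_uval_eq_torus_mul_uval h.isRootHom_weyl
    (surjective_of_mem_roots h.torus h.mem_roots) ht e).1

end RankOneOrbitData

end Raise

/-! ### The orbit cone: eigenlines, limits -/

section Cone

namespace RankOneOrbitData

variable {G T : Subgroup (GL n k)} {α : ↥(characterLattice T)} {u : Multiplicative k →* ↥G}
  {m : GL n k} {N : ℕ} {ρ : ↥G →* GL (Fin N) k} {v : Fin N → k}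
variable (h : RankOneOrbitData G T α u m ρ v)
include h

/-- The lowest weight vector `z₀ = ρ(m) v` (Springer's `y_∞`). [cite: SpringerLAG1998, 7.1.5 (proof)] -/
noncomputable def z0 : Fin N → k :=
  ((ρ ⟨m, h.memG⟩ : GL (Fin N) k) : Matrix (Fin N) (Fin N) k) *ᵥ v

/-- `z₀ = ρ(m) v`. [folklore] -/
theorem z0_def : h.z0 = ((ρ ⟨m, h.memG⟩ : GL (Fin N) k) : Matrix (Fin N) (Fin N) k) *ᵥ v := rfl

omit h in
/-- `ρ(g)` preserves the orbit cone. [folklore] -/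
theorem rho_mulVec_mem (g : ↥G) {w : Fin N → k} (hw : w ∈ orbitCone ρ.range v) :
    ((ρ g : GL (Fin N) k) : Matrix (Fin N) (Fin N) k) *ᵥ w ∈ orbitCone ρ.range v :=
  mulVec_mem_orbitCone (G := ρ.range) (MonoidHom.mem_range.2 ⟨g, rfl⟩) hw

omit h in
/-- `v` lies in the orbit cone. [folklore] -/
theorem v_mem : v ∈ orbitCone ρ.range v := self_mem_orbitCone

/-- `z₀` lies in the orbit cone. [folklore] -/
theorem z0_mem : h.z0 ∈ orbitCone ρ.range v := rho_mulVec_mem _ v_mem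

/-- `z₀ ≠ 0`. [folklore] -/
theorem z0_ne_zero : h.z0 ≠ 0 := by
  intro h0
  apply h.ne_zero
  have := congrArg (fun w => (((ρ ⟨m, h.memG⟩ : GL (Fin N) k)⁻¹ : GL (Fin N) k) :
    Matrix (Fin N) (Fin N) k) *ᵥ w) h0
  simpa [z0, Matrix.mulVec_mulVec, ← Units.val_mul] using this

/-- `v` is a `T`-eigenvector. [folklore] -/
theorem exists_rho_torus_v (t : ↥T) :
    ∃ c : k, ((ρ ⟨t, h.maxTorus.1 t.2⟩ : GL (Fin N) k) : Matrix (Fin N) (Fin N) k) *ᵥ v = c • v :=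
  h.exists_smul_of_mem_borel (h.maxTorus.1 t.2) (Subgroup.mem_sup_left t.2)

/-- `z₀` is a `T`-eigenvector (`ρ(t) ρ(m) v = ρ(m) ρ(m⁻¹ t m) v`). [folklore] -/
theorem exists_rho_torus_z0 (t : ↥T) :
    ∃ c : k, ((ρ ⟨t, h.maxTorus.1 t.2⟩ : GL (Fin N) k) : Matrix (Fin N) (Fin N) k) *ᵥ h.z0 =
      c • h.z0 := by
  have ht' : m⁻¹ * t * m ∈ T := (Subgroup.mem_normalizer_iff''.1 h.memN _).1 t.2
  obtain ⟨c, hc⟩ := h.exists_rho_torus_v ⟨_, ht'⟩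
  refine ⟨c, ?_⟩
  rw [z0, ← rho_mul_mulVec, show (⟨(t : GL n k), h.maxTorus.1 t.2⟩ : ↥G) * ⟨m, h.memG⟩ =
    ⟨m, h.memG⟩ * ⟨m⁻¹ * t * m, h.maxTorus.1 ht'⟩ from Subtype.ext (by simp [mul_assoc]),
    rho_mul_mulVec, hc, Matrix.mulVec_smul]

/-- The characters on the support of a `T`-eigenvector agree. [folklore] -/
theorem wt_eq_of_eigen {w : Fin N → k}
    (hfix : ∀ t : ↥T, ∃ c : k, ((ρ ⟨t, h.maxTorus.1 t.2⟩ : GL (Fin N) k) :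
      Matrix (Fin N) (Fin N) k) *ᵥ w = c • w) {i j : Fin N} (hi : w i ≠ 0) (hj : w j ≠ 0) :
    h.wt i = h.wt j := by
  ext t : 2
  have h1 := hfix t
  rw [h.rho_torus_mulVec, exists_smul_iff_forall_eq] at h1
  exact h1 i j hi hj

/-- A point of the orbit cone whose line is `T`-fixed is a multiple of `v` or of `z₀`. [cite: SpringerLAG1998, 7.1.5 (proof)] -/
theorem smul_or_smul_of_fixed_mem [IsAlgClosed k] {w : Fin N → k} (hw : w ∈ orbitCone ρ.range v)
    (hfix : ∀ t : ↥T, ∃ c : k, ((ρ ⟨t, h.maxTorus.1 t.2⟩ : GL (Fin N) k) :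
      Matrix (Fin N) (Fin N) k) *ᵥ w = c • w) :
    (∃ c : k, w = c • v) ∨ ∃ c : k, w = c • h.z0 := by
  obtain ⟨a, _, ⟨g, rfl⟩, rfl⟩ := hw
  by_cases ha : a = 0
  · exact Or.inl ⟨0, by rw [ha, zero_smul, zero_smul]⟩
  have hfix' : ∀ t : ↥T, ∃ c : k, ((ρ ⟨t, h.maxTorus.1 t.2⟩ : GL (Fin N) k) :
      Matrix (Fin N) (Fin N) k) *ᵥ (((ρ g : GL (Fin N) k) : Matrix (Fin N) (Fin N) k) *ᵥ v) =
      c • (((ρ g : GL (Fin N) k) : Matrix (Fin N) (Fin N) k) *ᵥ v) := by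
    intro t
    obtain ⟨c, hc⟩ := hfix t
    refine ⟨c, ?_⟩
    rw [Matrix.mulVec_smul, smul_comm] at hc
    exact smul_right_injective _ ha hc
  rcases h.smul_or_smul_of_fixed hfix' with ⟨c, hc⟩ | ⟨c, hc⟩
  · exact Or.inl ⟨a * c, by rw [hc, smul_smul]⟩
  · exact Or.inr ⟨a * c, by rw [hc, smul_smul]; rfl⟩

variable [IsAlgClosed k] [IsMulCommutative ↥T]

/-- **The lowest-weight part of a point of the (closed) orbit cone lies in the orbit cone**
(`ConeWeights.botPart_mem_of_isClosed` with `ρ(γ(c)) = diag(c^{mᵢ})`). [cite: SpringerLAG1998, 7.1.5 (proof)] -/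
theorem botPart_mem (γ : ↥(cocharacterLattice T)) {w : Fin N → k} (hw : w ∈ orbitCone ρ.range v) :
    botPart (h.wtInt γ) w ∈ orbitCone ρ.range v :=
  botPart_mem_of_isClosed _ _ isConeSet_orbitCone h.closed fun c => by
    rw [← h.rho_cochar γ c]; exact rho_mulVec_mem _ hw

/-- The highest-weight part likewise. [cite: SpringerLAG1998, 7.1.5 (proof)] -/
theorem topPart_mem (γ : ↥(cocharacterLattice T)) {w : Fin N → k} (hw : w ∈ orbitCone ρ.range v) :
    botPart (fun i => -h.wtInt γ i) w ∈ orbitCone ρ.range v :=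
  topPart_mem_of_isClosed _ _ isConeSet_orbitCone h.closed fun c => by
    rw [← h.rho_cochar γ c]; exact rho_mulVec_mem _ hw

/-- **The limit points are `T`-fixed**: the line of the lowest-weight part of a point of the
orbit cone is fixed by `ρ(T)` (separation of weights). [cite: SpringerLAG1998, 7.1.5 (proof)] -/
theorem botPart_fixed_torus {γ : ↥(cocharacterLattice T)}
    (hγ : charPairingInt (α : ↥T →* kˣ) (γ : kˣ →* ↥T) ≠ 0) {w : Fin N → k}
    (hw : w ∈ orbitCone ρ.range v) (t : ↥T) :
    ∃ c : k, ((ρ ⟨t, h.maxTorus.1 t.2⟩ : GL (Fin N) k) : Matrix (Fin N) (Fin N) k) *ᵥ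
      botPart (h.wtInt γ) w = c • botPart (h.wtInt γ) w := by
  rw [h.rho_torus_mulVec, exists_smul_iff_forall_eq]
  intro i j hi hj
  have e := h.wt_eq_of_wtInt_eq hγ (h.botPart_mem γ hw) hi hj
    ((botPart_apply_ne_zero _ _ hi).2.trans (botPart_apply_ne_zero _ _ hj).2.symm)
  rw [e]

/-- The same for the highest-weight part. [cite: SpringerLAG1998, 7.1.5 (proof)] -/
theorem topPart_fixed_torus {γ : ↥(cocharacterLattice T)}
    (hγ : charPairingInt (α : ↥T →* kˣ) (γ : kˣ →* ↥T) ≠ 0) {w : Fin N → k}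
    (hw : w ∈ orbitCone ρ.range v) (t : ↥T) :
    ∃ c : k, ((ρ ⟨t, h.maxTorus.1 t.2⟩ : GL (Fin N) k) : Matrix (Fin N) (Fin N) k) *ᵥ
      botPart (fun i => -h.wtInt γ i) w = c • botPart (fun i => -h.wtInt γ i) w := by
  rw [h.rho_torus_mulVec, exists_smul_iff_forall_eq]
  intro i j hi hj
  have e1 := (botPart_apply_ne_zero _ _ hi).2
  have e2 := (botPart_apply_ne_zero _ _ hj).2
  have e := h.wt_eq_of_wtInt_eq hγ (h.topPart_mem γ hw) hi hj (by
    have := e1.trans e2.symm; simpa using this)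
  rw [e]

/-- **`lim_{c → 0}` of a point of `G · [v]` is `[v]` or `[z₀]`.** [cite: SpringerLAG1998, 7.1.5 (proof)] -/
theorem botPart_smul_or_smul {γ : ↥(cocharacterLattice T)}
    (hγ : charPairingInt (α : ↥T →* kˣ) (γ : kˣ →* ↥T) ≠ 0) {w : Fin N → k}
    (hw : w ∈ orbitCone ρ.range v) :
    (∃ c : k, botPart (h.wtInt γ) w = c • v) ∨ ∃ c : k, botPart (h.wtInt γ) w = c • h.z0 :=
  h.smul_or_smul_of_fixed_mem (h.botPart_mem γ hw) (h.botPart_fixed_torus hγ hw)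

/-- **`lim_{c → ∞}` of a point of `G · [v]` is `[v]` or `[z₀]`.** [cite: SpringerLAG1998, 7.1.5 (proof)] -/
theorem topPart_smul_or_smul {γ : ↥(cocharacterLattice T)}
    (hγ : charPairingInt (α : ↥T →* kˣ) (γ : kˣ →* ↥T) ≠ 0) {w : Fin N → k}
    (hw : w ∈ orbitCone ρ.range v) :
    (∃ c : k, botPart (fun i => -h.wtInt γ i) w = c • v) ∨
      ∃ c : k, botPart (fun i => -h.wtInt γ i) w = c • h.z0 :=
  h.smul_or_smul_of_fixed_mem (h.topPart_mem γ hw) (h.topPart_fixed_torus hγ hw)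

/-! #### The extremal weights `M₀` (of `v`) and `M_∞` (of `z₀`) -/

variable (γ : ↥(cocharacterLattice T))

/-- The `γ`-weight `M₀` of `v`. [cite: SpringerLAG1998, 7.1.5 (proof)] -/
noncomputable def Mv : ℤ := minWeight (h.wtInt γ) v

/-- The `γ`-weight `M_∞` of `z₀`. [cite: SpringerLAG1998, 7.1.5 (proof)] -/
noncomputable def Mz : ℤ := minWeight (h.wtInt γ) h.z0

variable {γ}

omit [IsAlgClosed k] in
/-- A `T`-eigenvector has a single `γ`-weight, its `minWeight`. [folklore] -/
theorem wtInt_eq_minWeight_of_eigen {w : Fin N → k} (hw0 : w ≠ 0)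
    (hfix : ∀ t : ↥T, ∃ c : k, ((ρ ⟨t, h.maxTorus.1 t.2⟩ : GL (Fin N) k) :
      Matrix (Fin N) (Fin N) k) *ᵥ w = c • w) {j : Fin N} (hj : w j ≠ 0) :
    h.wtInt γ j = minWeight (h.wtInt γ) w := by
  obtain ⟨i, hi⟩ := Function.ne_iff.1 (botPart_ne_zero (h.wtInt γ) w hw0)
  replace hi : botPart (h.wtInt γ) w i ≠ 0 := by simpa using hi
  obtain ⟨hwi, hmi⟩ := botPart_apply_ne_zero _ _ hi
  rw [← hmi]
  simp only [wtInt]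
  rw [h.wt_eq_of_eigen hfix hj hwi]

omit [IsAlgClosed k] in
/-- `v` has pure weight `M₀`. [folklore] -/
theorem wtInt_eq_Mv {j : Fin N} (hj : v j ≠ 0) : h.wtInt γ j = h.Mv γ :=
  h.wtInt_eq_minWeight_of_eigen h.ne_zero h.exists_rho_torus_v hj

omit [IsAlgClosed k] in
/-- `z₀` has pure weight `M_∞`. [folklore] -/
theorem wtInt_eq_Mz {j : Fin N} (hj : h.z0 j ≠ 0) : h.wtInt γ j = h.Mz γ :=
  h.wtInt_eq_minWeight_of_eigen h.z0_ne_zero h.exists_rho_torus_z0 hj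

/-- The top weight of a non-zero point of the orbit cone is `M₀` or `M_∞`. [cite: SpringerLAG1998, 7.1.5 (proof)] -/
theorem maxWeight_eq_or (hγ : charPairingInt (α : ↥T →* kˣ) (γ : kˣ →* ↥T) ≠ 0) {w : Fin N → k}
    (hw : w ∈ orbitCone ρ.range v) (hw0 : w ≠ 0) :
    -minWeight (fun i => -h.wtInt γ i) w = h.Mv γ ∨ -minWeight (fun i => -h.wtInt γ i) w = h.Mz γ := by
  obtain ⟨i, hi⟩ := Function.ne_iff.1 (botPart_ne_zero (fun i => -h.wtInt γ i) w hw0)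
  replace hi : botPart (fun i => -h.wtInt γ i) w i ≠ 0 := by simpa using hi
  obtain ⟨hwi, hmi⟩ := botPart_apply_ne_zero _ _ hi
  rcases h.topPart_smul_or_smul hγ hw with ⟨c, hc⟩ | ⟨c, hc⟩
  · left
    have hvi : v i ≠ 0 := by
      intro h0; apply hi; rw [hc, Pi.smul_apply, h0, smul_zero]
    rw [← h.wtInt_eq_Mv hvi, ← hmi, neg_neg]
  · right
    have hzi : h.z0 i ≠ 0 := by
      intro h0; apply hi; rw [hc, Pi.smul_apply, h0, smul_zero]
    rw [← h.wtInt_eq_Mz hzi, ← hmi, neg_neg]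

/-- The bottom weight of a non-zero point of the orbit cone is `M₀` or `M_∞`. [cite: SpringerLAG1998, 7.1.5 (proof)] -/
theorem minWeight_eq_or (hγ : charPairingInt (α : ↥T →* kˣ) (γ : kˣ →* ↥T) ≠ 0) {w : Fin N → k}
    (hw : w ∈ orbitCone ρ.range v) (hw0 : w ≠ 0) :
    minWeight (h.wtInt γ) w = h.Mv γ ∨ minWeight (h.wtInt γ) w = h.Mz γ := by
  obtain ⟨i, hi⟩ := Function.ne_iff.1 (botPart_ne_zero (h.wtInt γ) w hw0)
  replace hi : botPart (h.wtInt γ) w i ≠ 0 := by simpa using hi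
  obtain ⟨hwi, hmi⟩ := botPart_apply_ne_zero _ _ hi
  rcases h.botPart_smul_or_smul hγ hw with ⟨c, hc⟩ | ⟨c, hc⟩
  · left
    have hvi : v i ≠ 0 := by
      intro h0; apply hi; rw [hc, Pi.smul_apply, h0, smul_zero]
    rw [← h.wtInt_eq_Mv hvi, ← hmi]
  · right
    have hzi : h.z0 i ≠ 0 := by
      intro h0; apply hi; rw [hc, Pi.smul_apply, h0, smul_zero]
    rw [← h.wtInt_eq_Mz hzi, ← hmi]

/-- **Orientation: `M_∞ < M₀`** (Springer 7.1.5: the weights are ordered so that `e₀` has the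
highest weight; here: `ρ(u(1)) z₀ ≠ z₀` by `eq_zero_of_rho_uval_fix`, so `ρ(u(1)) z₀` has a
coordinate of weight `> M_∞` since `U_α` raises weights, and its top weight is `M₀` or `M_∞`).
[cite: SpringerLAG1998, 7.1.5 (proof)] -/
theorem Mz_lt_Mv (hd : 0 < charPairingInt (α : ↥T →* kˣ) (γ : kˣ →* ↥T)) : h.Mz γ < h.Mv γ := by
  set w := ((ρ (u (Multiplicative.ofAdd (1 : k))) : GL (Fin N) k) : Matrix (Fin N) (Fin N) k) *ᵥ h.z0
    with hw
  have hwC : w ∈ orbitCone ρ.range v := rho_mulVec_mem _ h.z0_mem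
  have hz : ∀ j, h.z0 j ≠ 0 → h.wtInt γ j = h.Mz γ := fun j hj => h.wtInt_eq_Mz hj
  -- a coordinate of `w` of weight `> M_∞`
  obtain ⟨i, hwi, hgt⟩ : ∃ i, w i ≠ 0 ∧ h.Mz γ < h.wtInt γ i := by
    by_contra hcon
    push Not at hcon
    have hwz : w = h.z0 := by
      funext i
      by_cases hle : h.wtInt γ i ≤ h.Mz γ
      · rw [hw, h.rho_uval_mulVec_apply hd hz 1 i hle]
        split_ifs with heq
        · rfl
        · by_contra hzi
          exact heq (hz i (Ne.symm hzi))
      · push Not at hle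
        have h1 : w i = 0 := by
          by_contra hwi; exact absurd (hcon i hwi) (not_le.2 hle)
        rw [h1]
        by_contra hzi
        exact absurd (hz i (Ne.symm hzi)) (ne_of_gt hle)
    have hwz' : ((ρ (u (Multiplicative.ofAdd (1 : k))) : GL (Fin N) k) : Matrix (Fin N) (Fin N) k) *ᵥ
        (((ρ ⟨m, h.memG⟩ : GL (Fin N) k) : Matrix (Fin N) (Fin N) k) *ᵥ v) =
        ((ρ ⟨m, h.memG⟩ : GL (Fin N) k) : Matrix (Fin N) (Fin N) k) *ᵥ v := hwz
    exact one_ne_zero (h.eq_zero_of_rho_uval_fix hwz')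
  have hw0 : w ≠ 0 := fun h0 => hwi (by rw [h0]; rfl)
  have htop : h.wtInt γ i ≤ -minWeight (fun i => -h.wtInt γ i) w := by
    have := minWeight_le (fun i => -h.wtInt γ i) w hwi
    linarith
  rcases h.maxWeight_eq_or hd.ne' hwC hw0 with e | e
  · rw [e] at htop; exact lt_of_lt_of_le hgt htop
  · rw [e] at htop; exact absurd htop (not_le.2 hgt)

/-- Weights of the non-zero coordinates of a point of the orbit cone lie in `[M_∞, M₀]`. [folklore] -/
theorem wtInt_mem_Icc (hd : 0 < charPairingInt (α : ↥T →* kˣ) (γ : kˣ →* ↥T)) {w : Fin N → k}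
    (hw : w ∈ orbitCone ρ.range v) {i : Fin N} (hi : w i ≠ 0) :
    h.Mz γ ≤ h.wtInt γ i ∧ h.wtInt γ i ≤ h.Mv γ := by
  have hw0 : w ≠ 0 := fun h0 => hi (by rw [h0]; rfl)
  have hlt := h.Mz_lt_Mv hd
  have h1 := minWeight_le (h.wtInt γ) w hi
  have h2 := minWeight_le (fun i => -h.wtInt γ i) w hi
  constructor
  · rcases h.minWeight_eq_or hd.ne' hw hw0 with e | e <;> rw [e] at h1 <;> linarith
  · rcases h.maxWeight_eq_or hd.ne' hw hw0 with e | e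
    · have : h.wtInt γ i ≤ -minWeight (fun i => -h.wtInt γ i) w := by linarith
      rw [e] at this; exact this
    · have : h.wtInt γ i ≤ -minWeight (fun i => -h.wtInt γ i) w := by linarith
      rw [e] at this; linarith

/-- **The chart at `x_∞`: `X ∖ {x₀} ⊆ Ω_∞`.** A non-zero point of the orbit cone which is not a
multiple of `v` has lowest weight `M_∞`, and its weight-`M_∞` part is a non-zero multiple of `z₀`
(Springer 7.1.5: "*if the last coordinate of `x` is non-zero, then `x₀* = lim ρ(a) x*` exists*",
read backwards). [cite: SpringerLAG1998, 7.1.5 (proof)] -/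
theorem exists_low_coords (hd : 0 < charPairingInt (α : ↥T →* kˣ) (γ : kˣ →* ↥T)) {w : Fin N → k}
    (hw : w ∈ orbitCone ρ.range v) (hw0 : w ≠ 0) (hnv : ¬ ∃ c : k, w = c • v) :
    ∃ c : k, c ≠ 0 ∧ ∀ i, h.wtInt γ i = h.Mz γ → w i = c * h.z0 i := by
  have hlt := h.Mz_lt_Mv hd
  -- the lowest weight of `w` is `M_∞`
  have hmin : minWeight (h.wtInt γ) w = h.Mz γ := by
    rcases h.minWeight_eq_or hd.ne' hw hw0 with e | e
    · exfalso
      -- then `w` is pure of weight `M₀`, hence equal to its bottom part, a multiple of `v`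
      have hpure : ∀ i, w i ≠ 0 → h.wtInt γ i = h.Mv γ := fun i hi =>
        le_antisymm (h.wtInt_mem_Icc hd hw hi).2 (e ▸ minWeight_le (h.wtInt γ) w hi)
      have hwb : w = botPart (h.wtInt γ) w := by
        funext i
        by_cases hi : w i = 0
        · unfold botPart; split_ifs <;> simp [hi]
        · unfold botPart; rw [if_pos ((hpure i hi).trans e.symm)]
      rcases h.botPart_smul_or_smul hd.ne' hw with ⟨c, hc⟩ | ⟨c, hc⟩
      · exact hnv ⟨c, hwb.trans hc⟩
      · obtain ⟨i, hi⟩ := Function.ne_iff.1 hw0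
        replace hi : w i ≠ 0 := by simpa using hi
        have hzi : h.z0 i ≠ 0 := by
          intro h0
          apply hi
          rw [hwb, hc, Pi.smul_apply, h0, smul_zero]
        have := (hpure i hi).symm.trans (h.wtInt_eq_Mz hzi)
        exact absurd this (ne_of_gt hlt)
    · exact e
  rcases h.botPart_smul_or_smul hd.ne' hw with ⟨c, hc⟩ | ⟨c, hc⟩
  · exfalso
    obtain ⟨i, hi⟩ := Function.ne_iff.1 (botPart_ne_zero (h.wtInt γ) w hw0)
    replace hi : botPart (h.wtInt γ) w i ≠ 0 := by simpa using hi
    have hvi : v i ≠ 0 := by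
      intro h0; apply hi; rw [hc, Pi.smul_apply, h0, smul_zero]
    have e1 := (botPart_apply_ne_zero _ _ hi).2
    rw [hmin, h.wtInt_eq_Mv hvi] at e1
    exact absurd e1 (ne_of_gt hlt)
  · refine ⟨c, ?_, fun i hi => ?_⟩
    · rintro rfl
      rw [zero_smul] at hc
      exact botPart_ne_zero _ _ hw0 hc
    · have := congrFun hc i
      rw [Pi.smul_apply, smul_eq_mul] at this
      rw [← this]
      unfold botPart
      rw [if_pos (hi.trans hmin.symm)]

/-- **The chart at `x₀`: `X ∖ {x_∞} ⊆ Ω₀`.** A non-zero point of the orbit cone which is not a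
multiple of `z₀` has top weight `M₀` and weight-`M₀` part a non-zero multiple of `v`. [cite: SpringerLAG1998, 7.1.5 (proof)] -/
theorem exists_high_coords (hd : 0 < charPairingInt (α : ↥T →* kˣ) (γ : kˣ →* ↥T)) {w : Fin N → k}
    (hw : w ∈ orbitCone ρ.range v) (hw0 : w ≠ 0) (hnz : ¬ ∃ c : k, w = c • h.z0) :
    ∃ c : k, c ≠ 0 ∧ ∀ i, h.wtInt γ i = h.Mv γ → w i = c * v i := by
  have hlt := h.Mz_lt_Mv hd
  have hmax : -minWeight (fun i => -h.wtInt γ i) w = h.Mv γ := by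
    rcases h.maxWeight_eq_or hd.ne' hw hw0 with e | e
    · exact e
    · exfalso
      have hpure : ∀ i, w i ≠ 0 → h.wtInt γ i = h.Mz γ := fun i hi => by
        refine le_antisymm ?_ (h.wtInt_mem_Icc hd hw hi).1
        have := minWeight_le (fun i => -h.wtInt γ i) w hi
        linarith
      have hwb : w = botPart (fun i => -h.wtInt γ i) w := by
        funext i
        by_cases hi : w i = 0
        · unfold botPart; split_ifs <;> simp [hi]
        · unfold botPart
          rw [if_pos]
          have := hpure i hi
          linarith
      rcases h.topPart_smul_or_smul hd.ne' hw with ⟨c, hc⟩ | ⟨c, hc⟩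
      · obtain ⟨i, hi⟩ := Function.ne_iff.1 hw0
        replace hi : w i ≠ 0 := by simpa using hi
        have hvi : v i ≠ 0 := by
          intro h0
          apply hi
          rw [hwb, hc, Pi.smul_apply, h0, smul_zero]
        have := (hpure i hi).symm.trans (h.wtInt_eq_Mv hvi)
        exact absurd this (ne_of_lt hlt)
      · exact hnz ⟨c, hwb.trans hc⟩
  rcases h.topPart_smul_or_smul hd.ne' hw with ⟨c, hc⟩ | ⟨c, hc⟩
  · refine ⟨c, ?_, fun i hi => ?_⟩
    · rintro rfl
      rw [zero_smul] at hc
      exact botPart_ne_zero _ _ hw0 hc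
    · have := congrFun hc i
      rw [Pi.smul_apply, smul_eq_mul] at this
      rw [← this]
      unfold botPart
      rw [if_pos]
      linarith
  · exfalso
    obtain ⟨i, hi⟩ := Function.ne_iff.1 (botPart_ne_zero (fun i => -h.wtInt γ i) w hw0)
    replace hi : botPart (fun i => -h.wtInt γ i) w i ≠ 0 := by simpa using hi
    have hzi : h.z0 i ≠ 0 := by
      intro h0; apply hi; rw [hc, Pi.smul_apply, h0, smul_zero]
    have e1 := (botPart_apply_ne_zero _ _ hi).2
    have e2 := h.wtInt_eq_Mz (γ := γ) hzi
    have : h.wtInt γ i = h.Mv γ := by linarith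
    exact absurd (e2.symm.trans this) (ne_of_lt hlt)

end RankOneOrbitData

end Cone

end Literature.NumberTheory.Automorphic
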